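import Literature.IUT.HodgeTheaters.GenuineFKitMergeInputsGoodSlotModelCase
import Literature.IUT.HodgeTheaters.Cor53iiAtArchPlace
import Literature.IUT.HodgeTheaters.Cor53iiAtBadPlaceByName
import HarnessLib

/-!
# [IUTchI] Cor 5.3 (ii) — THREE-SLOT KNIT of the telescope of record at the genuine `ℱ`-kit (good nonarchimedean · bad · archimedean):
# at EVERY index the natural map «automorphisms of the `ℱ`-datum ↦ automorphisms of the `𝒟`-datum» is BIJECTIVE at the slot's genuine carrier,
# each slot RE-EXPORTED BY NAME from its landed file and the three conjoined under the kit's binders (PROOF-ONLY — 0 def · 0 instance · 0 notation · no `Prop` fact)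

S. Mochizuki, *Inter-universal Teichmüller theory I*, kurims manuscript (May 2020), §5 Corollary 5.3 (ii) p. 144 («For `i = 1, 2`, let `ⁱ𝔉` be an
`ℱ`-prime-strip; `ⁱ𝔇` the `𝒟`-prime-strip associated to `ⁱ𝔉` [cf. Remark 5.2.1, (i)]. Then the natural map `Isom(¹𝔉, ²𝔉) → Isom(¹𝔇, ²𝔇)` [cf. Remark
5.2.1, (i)] is bijective»; proof l. 33–36 «follows immediately from [AbsTopIII], Proposition 3.2, (iv); [AbsTopIII], Proposition 4.2, (i) [cf. …
Definition 5.2, (vi), (viii)]»); Definition 5.2 (i) p. 134 (an `ℱ`-prime-strip `‡𝔉 = {‡ℱ_v̲}_{v̲∈V̲}`: (a) at `v̲ ∈ V̲^non` «a category `‡𝒞_v̲` which admits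
an equivalence of categories `‡𝒞_v̲ ⥲ 𝒞_v̲` [where `𝒞_v̲` is as in Examples 3.2, (iii) [bad]; 3.3, (i) [good]]», (b) at `v̲ ∈ V̲^arc` the triple of Example
3.4 (i)), (iii) p. 134 (a morphism of prime-strips is «a collection of isomorphisms, indexed by `V̲`, between the various constituent objects»).
([IUTchI] Cor 5.3 (ii) p.144) [claim: Mochizuki2012, status: disputed] (D-0012 claim key, series status DISPUTED — a CONJUNCTION of three landed kernel
theorems over the cell's GENUINE local carriers; nothing of the series is asserted; no side is taken on [IUTchIII] Cor. 3.12).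

## What this file proves (cell abc-iut, seat abc-iut-w4-d109 gen 10, KEY step (C) of row «COR53II-BAD-SLOT-BYNAME@TMPAIR»; abc-iut-L5-lead RULINGS
#137/#142/#180: the (ii) telescope of record = GOOD ✓ ★ p513350 · ARCH ✓ ★ p499353 · BAD = ★ p540102; pattern = abc-iut-L5-t4's `Cor53iiiTelescopeKnit`)

A morphism of `ℱ`-prime-strips is indexed by `V̲` (Def 5.2 (iii)), so «bijective» in (ii) is the conjunction over the index set `D.IndexCopy` of the genuine
`ℱ`-kit (abc-iut-L5's `GenuineFKitOfBadLocal` / `GenuineFKitMergeInputs*`, merge record `I : D.MergeInputs B`) of three per-place-type bijectivities, each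
already a THEOREM of the tree at the genuine carrier of its slot — this file re-exports them BY NAME and conjoins them, nothing else:

| slot | index `x` | carrier | landed headline (re-exported BY NAME) | census |
|---|---|---|---|---|
| GOOD | `x ∉ D.indexCopyArc`, `x ∉ D.indexCopyBad` | the (S1) slot of record `goodLiftToDAt` over `D.frobeniusGoodAt CG hA B I x hx` (`Π_v̲ = Π_{X̲→_K} ×_{G_K} G_v̲`) | abc-iut-L5-t16 `InitialThetaData.goodLiftAt_model_case_of_facts` (★ p513350) | kit binders ∪ {I, x, hx, hxb} · FACT {F-1979 `Rmk253.TameGaloisCountable`, F-0004 `GeomAndArithSlim`} · LAW ∅ |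
| BAD | `x ∈ D.indexCopyBad` | the MLF-Galois `TM`-pair `(Π_{X̳̲_v̲} ↷ 𝒪^▷_{K̄_v̲}) = (I.m2 x hx).tmPair` of the [IUTchI] Ex 3.2 (i) group datum (Def 5.2 (v)/(vi)) | abc-iut-w4-d109 `Cor53ii.mergeInputs_bad_tmPairIso_bijective` (★ p540102; hker ⟸ F-0174, hlift ⟸ F-0409@open-aug, both PROVED) | {D, B, I, x, hx} · FACT ∅ · LAW ∅ · displayed {hf} inside the target subtype |
| ARCH | `x ∈ D.indexCopyArc` | the Rmk 4.1.1-resolution slot `ArchFSlot 𝔄 ℂ → EA` over the term's carrier `D.frobeniusArcAt x hx = ArchLocalFrobenioid.ofArchFrd` | abc-iut-w4-d078 `ArchFSlot.descendBijective_toEA` (★ p499353) | {𝔄, he, hu} (he/hu INHABITED: `ArchFSlot.hasUnder_underUnique_toEA`) · FACT ∅ · LAW ∅ |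

* §1 `good_modelCase_bijective` — GOOD slot at the merge term, by name; §2 the BAD slot is the landed `mergeInputs_bad_tmPairIso_bijective` itself (no re-export); §3
  `arch_descendBijective_frobeniusArcAt` + `arch_binders_inhabited_frobeniusArcAt` — ARCH slot over the merge term's archimedean carrier, by name;
* §4 **`Cor53ii.threeSlot_bijective`** — the CONJUNCTION under the kit's binders {`D`, `CG`, `hS`, `M`, `hA`, `hI`, `B`, `ΛBad`, `I`} and the two frozen FACTS
  of the GOOD slot {`hE2` F-1979, `h` F-0004} ONLY.
READINGS (each inherited from its slot file, unchanged): GOOD — the model case «`α ↦ toD(α)` bijective on the automorphisms of the slot's reference object»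
(abc-iut-L5-t4's `FKit` currency, ★ p498387 / ★ p510109); BAD — at the `TM`-PAIR of Def 5.2 (v)/(vi) (print's own carrier for «[AbsTopIII], Proposition
3.2, (iv)»), NOT at the INPUT category `(I.m1 x hx).Cv` of abc-iut-L5-t2's `TemperedThetaInput` (INPUT-SHAPE label of the L5 desk: the I.m1 hull must expose
this `TM`-pair through a Galois-reading faithful functor; lane 1 = abc-iut-L5-t4's `Cor53iiBadSlot*AtStandIn`); ARCH — the §0 `hker/hlift` shape DISCHARGED
because the slot is EQUIVALENT to its base (Rmk 4.1.1 resolution, abc-iut-w4-d078's HONEST LABEL).  NOT claimed: the token IUTchI:Cor5.3(ii) (the L5-lead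
decides); any statement about `(I.m1 x hx).Cv`; Cor. 5.3 (ii) itself.  HONEST FRAMING: bijectivity at OUR carriers is OUR theorem; typed ≠ inhabited ≠ proved
beyond what is here; nothing asserts that `I` is inhabited at the tempered fundamental groups of an actual Tate curve; nothing here asserts abc proved or refuted.
-/

noncomputable section

namespace Literature.IUT.HodgeTheaters

open CategoryTheory Literature.AnabelianGeometry.AbsoluteAnabelian Literature.NumberTheory.GaloisRepresentations

namespace Cor53ii

section AtTerm

variable {F K Fbar : Type} [Field F] [NumberField F] [Field K] [NumberField K] [Algebra F K]
  [Field Fbar] [Algebra F Fbar] [Algebra K Fbar]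
  {E : WeierstrassCurve F} [E.IsElliptic] {l : ℕ} {Pb : BadPlacePredicates K}
  (D : InitialThetaData F K Fbar E l Pb) (CG : D.geom.pe.CuspGalois) (hS : D.CuspClassesNormaliserStable) [Fact l.Prime]
  (M : D.TorsionMonodromy) (hA : D.geom.pe.ArrowCoveringClaims)
  (hI : ∀ k ∈ D.geom.pe.inertia D.geom.pe.ε1, M.tau (D.geom.embK k) = 0)
  (B : ∀ v, v ∈ D.indexCopyBad → D.BadPairAt v) (ΛBad : ∀ v (h : v ∈ D.indexCopyBad), D.LocalArrowLaw CG hS (B v h).H)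
  (I : D.MergeInputs B)

/-! ### §1. GOOD nonarchimedean slot (abc-iut-L5-t16 ★ p513350, by name) -/

/-- **GOOD slot of [IUTchI] Cor 5.3 (ii) at the merge term** — RE-EXPORT BY NAME of abc-iut-L5-t16's `InitialThetaData.goodLiftAt_model_case_of_facts`: at
every good nonarchimedean index `x` (`x ∉ D.indexCopyArc`, `x ∉ D.indexCopyBad`), «`α ↦ toD(α)`» on the automorphisms of the reference object of the (S1) slot
of record (`goodLiftToDAt`) is BIJECTIVE, modulo ONLY the frozen FACTS F-1979 (E2) `Rmk253.TameGaloisCountable` and F-0004 `GeomAndArithSlim`.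
([IUTchI] Cor 5.3 (ii) p.144) [claim: Mochizuki2012, status: disputed] -/
theorem good_modelCase_bijective (hE2 : Rmk253.TameGaloisCountable D.geom.extF)
    (h : Literature.AnabelianGeometry.AbsoluteAnabelian.FundamentalExtension.GeomAndArithSlim D.geom.extF)
    (x : D.IndexCopy) (hx : x ∉ D.indexCopyArc) (hxb : x ∉ D.indexCopyBad) [Fact (D.primeAt x hx).Prime] :
    letI := GaloisValDatum.normVal (D.KvAt x hx)
    Function.Bijective (fun α : SingleObj.star _ ≅ SingleObj.star _ =>
        (show (D.baseKitThetaNFOfBadPairs CG hS M hA hI B ΛBad).model x ≅ (D.baseKitThetaNFOfBadPairs CG hS M hA hI B ΛBad).model x from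
          (D.goodLiftToDAt CG hS M hA hI B ΛBad I x hx hxb).mapIso α)) :=
  D.goodLiftAt_model_case_of_facts CG hS M hA hI B ΛBad I x hx hxb hE2 h

/-! ### §2. BAD slot (abc-iut-w4-d109 ★ p540102): NO re-export — the landed `Cor53ii.mergeInputs_bad_tmPairIso_bijective D B I x hx`
(`Cor53iiAtBadPlaceByName.lean` §4) is already stated at the merge term and is used BY NAME in §4 below (a verbatim re-export would be a
duplicate declaration; gate rule `dedup.landed`). -/

/-! ### §3. ARCHIMEDEAN slot (abc-iut-w4-d078 ★ p499353, by name) over the merge term's archimedean carrier -/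

omit [Fact l.Prime] in
/-- **ARCH slot of [IUTchI] Cor 5.3 (ii) over the merge term's archimedean carrier** — RE-EXPORT BY NAME of abc-iut-w4-d078's `ArchFSlot.descendBijective_toEA`
at the datum `X₀ := D.frobeniusArcAt x hx` (`= ArchLocalFrobenioid.ofArchFrd`, `K_v̲ ≅ ℂ`): at every archimedean index, for every holomorphic-field functor `𝔄`
and every choice of the §0 binders `he`/`hu`, the natural map `Aut(ArchFSlot 𝔄 ℂ) → Aut(EA)` is bijective (the slot is EQUIVALENT to its base — Rmk 4.1.1
resolution; abc-iut-w4-d078's HONEST LABEL inherited). ([IUTchI] Cor 5.3 (ii) p.144) [claim: Mochizuki2012, status: disputed] -/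
theorem arch_descendBijective_frobeniusArcAt (x : D.IndexCopy) (hx : x ∈ D.indexCopyArc) (𝔄 : AutHolFieldFunctor.{0})
    (he : CatIsomorphism.HasUnder (ArchFSlot.toEA 𝔄 ℂ) (ArchFSlot.toEA 𝔄 ℂ))
    (hu : CatIsomorphism.UnderUnique (ArchFSlot.toEA 𝔄 ℂ) (ArchFSlot.toEA 𝔄 ℂ)) :
    CatIsomorphism.DescendBijective (ArchFSlot.toEA 𝔄 ℂ) (ArchFSlot.toEA 𝔄 ℂ) he hu :=
  ArchFSlot.descendBijective_toEA 𝔄 ℂ (D.frobeniusArcAt x hx) he hu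

omit [Fact l.Prime] in
/-- **NON-VACUITY of the ARCH slot's §0 binders at the merge term**: `he`/`hu` are INHABITED over the term's archimedean carrier (abc-iut-w4-d078's
`ArchFSlot.hasUnder_underUnique_toEA` at `D.frobeniusArcAt x hx`). ([IUTchI] Cor 5.3 (ii) p.144) [claim: Mochizuki2012, status: disputed] -/
theorem arch_binders_inhabited_frobeniusArcAt (x : D.IndexCopy) (hx : x ∈ D.indexCopyArc) (𝔄 : AutHolFieldFunctor.{0}) :
    CatIsomorphism.HasUnder (ArchFSlot.toEA 𝔄 ℂ) (ArchFSlot.toEA 𝔄 ℂ) ∧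
      CatIsomorphism.UnderUnique (ArchFSlot.toEA 𝔄 ℂ) (ArchFSlot.toEA 𝔄 ℂ) :=
  ArchFSlot.hasUnder_underUnique_toEA 𝔄 ℂ (D.frobeniusArcAt x hx)

/-! ### §4. The THREE-SLOT KNIT -/

/-- **[IUTchI] Cor 5.3 (ii) — THREE-SLOT KNIT at the genuine `ℱ`-kit of record, under the kit's binders {`D`, `CG`, `hS`, `M`, `hA`, `hI`, `B`, `ΛBad`, `I`}
and the GOOD slot's two frozen FACTS {F-1979 `hE2`, F-0004 `h`} ONLY.**  «The natural map `Isom(¹𝔉, ²𝔉) → Isom(¹𝔇, ²𝔇)` is bijective», read index by index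
(Def 5.2 (iii)): (GOOD) at every good nonarchimedean `x`, the model case at the (S1) slot of record is bijective; (BAD) at every `x ∈ D.indexCopyBad`,
`Aut((Π_{X̳̲_v̲} ↷ 𝒪^▷_{K̄_v̲})) → {f ∈ Aut_{top}(Π_{X̳̲_v̲}) | f(Ker aug) = Ker aug}` is bijective at the genuine `TM`-pair of `I.m2 x hx`; (ARCH) at every `x ∈ D.indexCopyArc`,
the §0 binders are inhabited and for every choice of them `Aut(ArchFSlot 𝔄 ℂ) → Aut(EA)` is bijective over the term's carrier.  CENSUS: GOOD ★ p513350 (FACT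
{F-1979, F-0004}) · BAD ★ p540102 (FACT ∅ · LAW ∅) · ARCH ★ p499353 (FACT ∅ · LAW ∅), each BY NAME; LAW ∅ overall.  NOT claimed: anything about the INPUT
category `(I.m1 x hx).Cv` (INPUT-SHAPE label of the L5 desk); the token (L5-lead decides). ([IUTchI] Cor 5.3 (ii) p.144) [claim: Mochizuki2012, status: disputed] -/
theorem threeSlot_bijective (hE2 : Rmk253.TameGaloisCountable D.geom.extF)
    (h : Literature.AnabelianGeometry.AbsoluteAnabelian.FundamentalExtension.GeomAndArithSlim D.geom.extF) :
    (∀ (x : D.IndexCopy) (hx : x ∉ D.indexCopyArc) (hxb : x ∉ D.indexCopyBad) [Fact (D.primeAt x hx).Prime],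
        letI := GaloisValDatum.normVal (D.KvAt x hx)
        Function.Bijective (fun α : SingleObj.star _ ≅ SingleObj.star _ =>
          (show (D.baseKitThetaNFOfBadPairs CG hS M hA hI B ΛBad).model x ≅ (D.baseKitThetaNFOfBadPairs CG hS M hA hI B ΛBad).model x from
            (D.goodLiftToDAt CG hS M hA hI B ΛBad I x hx hxb).mapIso α))) ∧
    (∀ (x : D.IndexCopy) (hx : x ∈ D.indexCopyBad),
        haveI := D.fact_primeAt_prime x (D.not_mem_arc_of_mem_bad hx)
        haveI := GaloisValDatum.finiteDimensional_rescaledCompletion K (D.primeAt x (D.not_mem_arc_of_mem_bad hx))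
          (D.specAt x (D.not_mem_arc_of_mem_bad hx)) (D.primeAt_mem x (D.not_mem_arc_of_mem_bad hx))
        Function.Bijective (fun e : GaloisMonoidPair.Iso (I.m2 x hx).tmPair (I.m2 x hx).tmPair =>
          (⟨e.isoPi, bad_isoPi_map_ker (I.m2 x hx) (I.m2 x hx) e⟩ :
            {f : ↥(B x hx).H ≃ₜ* ↥(B x hx).H // (I.m2 x hx).aug.ker.map f.toMulEquiv.toMonoidHom = (I.m2 x hx).aug.ker}))) ∧
    (∀ (x : D.IndexCopy) (_hx : x ∈ D.indexCopyArc) (𝔄 : AutHolFieldFunctor.{0}),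
        (CatIsomorphism.HasUnder (ArchFSlot.toEA 𝔄 ℂ) (ArchFSlot.toEA 𝔄 ℂ) ∧
          CatIsomorphism.UnderUnique (ArchFSlot.toEA 𝔄 ℂ) (ArchFSlot.toEA 𝔄 ℂ)) ∧
        ∀ (he : CatIsomorphism.HasUnder (ArchFSlot.toEA 𝔄 ℂ) (ArchFSlot.toEA 𝔄 ℂ))
          (hu : CatIsomorphism.UnderUnique (ArchFSlot.toEA 𝔄 ℂ) (ArchFSlot.toEA 𝔄 ℂ)),
          CatIsomorphism.DescendBijective (ArchFSlot.toEA 𝔄 ℂ) (ArchFSlot.toEA 𝔄 ℂ) he hu) :=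
  ⟨fun x hx hxb _ => good_modelCase_bijective D CG hS M hA hI B ΛBad I hE2 h x hx hxb,
    fun x hx => mergeInputs_bad_tmPairIso_bijective D B I x hx,
    fun x hx 𝔄 => ⟨arch_binders_inhabited_frobeniusArcAt D x hx 𝔄, fun he hu => arch_descendBijective_frobeniusArcAt D x hx 𝔄 he hu⟩⟩

end AtTerm

end Cor53ii

end Literature.IUT.HodgeTheaters

end
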